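import Mathlib.RingTheory.MvPolynomial.EulerIdentity
import Literature.Computability.AlgebraicComplexity.VonZurGathenSingPermHeight
import Literature.Computability.AlgebraicComplexity.AlperBogartVelascoLowOrder
import Literature.Computability.AlgebraicComplexity.AlperBogartVelascoIsotropy
import HarnessLib

/-!
# Alper–Bogart–Velasco, Thm. 1.2 for the permanent: the linear space `V(I)`

Topic `Literature/Computability/AlgebraicComplexity`; third file of the proof of the named fact
`alperBogartVelasco2017_cor_1_4` (`AlperBogartVelasco.lean`), following J. Alper, T. Bogart,
M. Velasco, *A lower bound for the determinantal complexity of a hypersurface*, Found. Comput.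
Math. 17 (2017) 829–836, §2 (arXiv:1505.02205 p. 4–5), specialised to `f = perm_m`, `m ≥ 3`,
over a field `K` with `2 ≠ 0`:

* `le_rank_map_eval_add_one` — ABV Prop. 2.1 = von zur Gathen 1987, Thm. 3.1: a polynomial matrix
  `A` with `det A = perm_m` has `rank A(v) ≥ n - 1` at every point.  The tree's named fact
  `vonzurGathen1987_perm_detRepr_rank` (PROVED, `VonZurGathenSingPermHeight.lean`) pins the field
  to universe `0` and asks it to be infinite; here the same proof is reassembled from its
  universe-polymorphic cores (`exists_minimalPrimes_adjIdeal_height_le_four`, Eagon's theorem,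
  and `five_le_height_of_vanishing`, vzG Lemma 2.3) for an arbitrary field with `2 ≠ 0`.
* `exists_subspace_of_isAffineDetRepr_perPoly` — the proof of Thm. 1.2 up to the dimension
  count: if `perm_m = det A` with `A` an `n × n` matrix of affine linear forms, then there is a
  linear subspace `W ⊆ K^{m×m}` (ABV's `V(I) = ker G`) with `dim W ≥ m² - (n - 1)` on which all
  partial derivatives of `perm_m` vanish.  Steps, as printed: `rank A(0) = n - 1` (Prop. 2.1 and
  `perm_m(0) = 0`); normal form `B = V A U = J + Z(x)` with `J = Λ_{i₀}`
  (`exists_mul_mul_eq_lamMatrix`); `Z₁₁ = 0` and the polarised `Σ_j Z_{1j} Z_{j1} = 0` from the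
  homogeneity of `perm_m` of degree `m > 2` (the coefficient identities of
  `AlperBogartVelascoLowOrder.lean` against `IsHomogeneous.pderiv`); `V(I) ⊆ Sing`
  (`eval_pderiv_det_eq_zero`); `codim V(I) = dim im G ≤ n - 1` (isotropy,
  `finrank_add_one_le_card_of_isotropic`).

## References

* J. Alper, T. Bogart, M. Velasco, Found. Comput. Math. 17 (2017) 829–836,
  doi:10.1007/s10208-015-9300-x, arXiv:1505.02205 — Prop. 2.1 and proof of Thm. 1.2.
* J. von zur Gathen, *Permanent and determinant*, Linear Algebra Appl. 96 (1987) 87–100,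
  Thm. 3.1, Lemma 2.3.
-/

noncomputable section

open Matrix MvPolynomial Finset Module

namespace Literature.Computability.AlgebraicComplexity

namespace AlperBogartVelasco

open VonZurGathen LRPencil

/-! ### ABV Prop. 2.1 (von zur Gathen's regularity), universe-polymorphic -/

/-- **von zur Gathen 1987, Lemma 2.3 (height form), any field with `2 ≠ 0`**: a prime of
`K[x_{ij}]` containing `perm_m` (`m ≥ 3`) and its partial derivatives has height `≥ 5`
(universe-polymorphic restatement of `vonzurGathen1987_singPerm_height_holds`, same proof).
[cite: Vonzurgathen1987, Lemma 2.3] -/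
theorem five_le_height_of_singPermIdeal_le {K : Type*} [Field K] (h2 : (2 : K) ≠ 0) {m : ℕ}
    (hm : 3 ≤ m) (P : Ideal (MvPolynomial (Fin m × Fin m) K)) [hP : P.IsPrime]
    (hle : singPermIdeal K m ≤ P) : (5 : ℕ∞) ≤ P.height := by
  let a : Fin m × Fin m → MvPolynomial (Fin m × Fin m) K ⧸ P := fun x => Ideal.Quotient.mk P (X x)
  have hker : RingHom.ker (aeval (R := K) a) = P := by
    have h : (aeval (R := K) a : MvPolynomial (Fin m × Fin m) K →ₐ[K] _ ⧸ P) =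
        Ideal.Quotient.mkₐ K P :=
      MvPolynomial.algHom_ext fun x => by simp [a]
    ext f
    rw [RingHom.mem_ker, show aeval (R := K) a f = Ideal.Quotient.mk P f by rw [h]; rfl,
      Ideal.Quotient.eq_zero_iff_mem]
  have hvan1 : ∀ r c, (Matrix.of fun r c => a (r, c)).subperm (· ≠ c) (· ≠ r) = 0 := by
    intro r c
    rw [← aeval_subperm_X (K := K) a, ← pderiv_perPoly, ← RingHom.mem_ker, hker]
    exact hle (pderiv_perPoly_mem_singPermIdeal K m (r, c))
  rw [← hker]
  exact five_le_height_of_vanishing h2 (by rw [Fintype.card_fin]; exact hm) a hvan1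

/-- **ABV Prop. 2.1 for the permanent** = **von zur Gathen 1987, Thm. 3.1**, over any field with
`2 ≠ 0` (no infinitude or algebraic closure needed in this height-theoretic form): if
`det A = perm_m` (`m ≥ 3`) for a square polynomial matrix `A` of size `n`, then
`rank A(v) + 1 ≥ n` at every point `v` ("`im(L) ∩ Sing(det_m) = ∅`").  Proof as in
`VonZurGathen.false_of_adjugate_eval_eq_zero`: if `rank A(v) ≤ n - 2` then all `(n-1)`-minors
vanish at `v`, so `I_{n-1}(A)` is proper, has a minimal prime of height `≤ 4` (Eagon), which
contains `perm_m` and its partials, hence has height `≥ 5`. [cite: AlperBogartVelasco2017, Prop. 2.1] -/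
theorem le_rank_map_eval_add_one {K : Type*} [Field K] (h2 : (2 : K) ≠ 0) {m : ℕ} (hm : 3 ≤ m)
    {n : ℕ} (A : Matrix (Fin n) (Fin n) (MvPolynomial (Fin m × Fin m) K))
    (hdet : A.det = perPoly (Fin m) K) (v : Fin m × Fin m → K) :
    n ≤ (A.map (MvPolynomial.eval v)).rank + 1 := by
  by_contra hlt
  push Not at hlt
  have hadj : (A.map (MvPolynomial.eval v)).adjugate = 0 := adjugate_eq_zero_of_rank_lt hlt
  rcases Nat.lt_or_ge n 2 with hn | hn
  · interval_cases n
    · have h0 := constantCoeff_perPoly K (show 1 ≤ m by omega)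
      rw [← hdet, Matrix.det_isEmpty, map_one] at h0
      exact one_ne_zero h0
    · have h1 := congrFun (congrFun hadj 0) 0
      rw [Matrix.adjugate_subsingleton, Matrix.one_apply_eq, Matrix.zero_apply] at h1
      exact one_ne_zero h1
  · have hA : (A.map (MvPolynomial.eval v)).adjugate = A.adjugate.map (MvPolynomial.eval v) := by
      show ((MvPolynomial.eval v).mapMatrix A).adjugate = _
      rw [← RingHom.map_adjugate]
      rfl
    have hle : adjIdeal A ≤ RingHom.ker (MvPolynomial.eval v) := by
      rw [adjIdeal, Ideal.span_le]
      rintro _ ⟨p, rfl⟩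
      rw [SetLike.mem_coe, RingHom.mem_ker]
      have := congrFun (congrFun hadj p.1) p.2
      rwa [hA, Matrix.map_apply, Matrix.zero_apply] at this
    have hne : adjIdeal A ≠ ⊤ := fun htop =>
      RingHom.ker_ne_top (MvPolynomial.eval v) (top_le_iff.1 (htop ▸ hle))
    obtain ⟨P, hP, hP4⟩ := exists_minimalPrimes_adjIdeal_height_le_four hn A hne
    haveI := hP.1.1
    have h5 : (5 : ℕ∞) ≤ P.height := five_le_height_of_singPermIdeal_le h2 hm P
      ((singPermIdeal_le_adjIdeal (by omega) A hdet).trans hP.1.2)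
    exact absurd (h5.trans hP4) (by decide)

/-! ### ABV Thm. 1.2 for the permanent, up to the dimension count -/

/-- **ABV, proof of Thm. 1.2, for `f = perm_m` (`m ≥ 3`, `2 ≠ 0` in `K`)**: an affine determinantal
representation of `perm_m` of size `n` yields a linear subspace `W ⊆ K^{m × m}` with
`dim W + (n - 1) ≥ m²` on which all the partial derivatives `∂ perm_m/∂x_{rc}` vanish — `W` is
ABV's `V(I) = ker G` for the normal form `J + Z(x)` of the representation, and
`codim V(I) = dim im(G) ≤ n - 1` because `im(G)` is an isotropic subspace of the split quadric
`Σ_j w_{1j} w_{j1}` inside `w_{11} = 0`.  (ABV then conclude `codim Sing(f) ≤ codim V(I) ≤ m - 1`;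
for `perm_3`, `perm_4` the sequel bounds `dim W` directly.) [cite: AlperBogartVelasco2017, Thm. 1.2] -/
theorem exists_subspace_of_isAffineDetRepr_perPoly {K : Type*} [Field K] (h2 : (2 : K) ≠ 0)
    {m : ℕ} (hm : 3 ≤ m) {n : ℕ} {A : Matrix (Fin n) (Fin n) (MvPolynomial (Fin m × Fin m) K)}
    (hA : IsAffineDetRepr (perPoly (Fin m) K) A) :
    ∃ W : Submodule K (Fin m × Fin m → K), m * m + 1 ≤ finrank K W + n ∧
      ∀ x ∈ W, ∀ rc : Fin m × Fin m,
        MvPolynomial.eval x (pderiv rc (perPoly (Fin m) K)) = 0 := by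
  obtain ⟨hdeg, hdet⟩ := hA
  -- `n ≥ 1`
  have hn : 0 < n := by
    rcases Nat.eq_zero_or_pos n with rfl | h
    · exfalso
      have h0 := constantCoeff_perPoly K (show 1 ≤ m by omega)
      rw [← hdet, Matrix.det_isEmpty, map_one] at h0
      exact one_ne_zero h0
    · exact h
  -- ABV Prop. 2.1: the constant part has rank exactly `n - 1`
  have hrank : (constPart A).rank = Fintype.card (Fin n) - 1 := by
    have hge : n ≤ (constPart A).rank + 1 := by
      rw [constPart_eq_map_eval_zero]
      exact le_rank_map_eval_add_one h2 hm A hdet 0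
    have hdet0 : (constPart A).det = 0 := by
      rw [det_constPart, hdet, constantCoeff_perPoly K (by omega)]
    have hlt := Matrix.rank_lt_card_of_det_eq_zero hdet0
    rw [Fintype.card_fin] at hlt ⊢
    omega
  -- normal form `B = V A U = J + Z(x)`, `J = Λ_{i₀}`
  obtain ⟨V, U, i₀, hV, hU, hVU⟩ :=
    exists_mul_mul_eq_lamMatrix (constPart A) hrank (by rw [Fintype.card_fin]; exact hn)
  set B : Matrix (Fin n) (Fin n) (MvPolynomial (Fin m × Fin m) K) := V.map C * A * U.map C
    with hB
  have hB0 : constPart B = lamMatrix K i₀ := by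
    rw [hB, constPart_mul, constPart_mul, constPart_map_C, constPart_map_C, hVU]
  have hB1 : ∀ r j, (B r j).totalDegree ≤ 1 := by
    intro r j
    rw [hB, Matrix.mul_apply]
    refine totalDegree_finsetSum_le fun l _ => ?_
    rw [Matrix.mul_apply, Matrix.map_apply]
    refine (totalDegree_mul _ _).trans ?_
    rw [totalDegree_C, add_zero]
    refine totalDegree_finsetSum_le fun k _ => ?_
    rw [Matrix.map_apply]
    refine (totalDegree_mul _ _).trans ?_
    rw [totalDegree_C, zero_add]
    exact hdeg k l
  -- `det B = c · perm_m`, `c ≠ 0`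
  set c : K := V.det * U.det with hc
  have hc0 : c ≠ 0 :=
    mul_ne_zero ((Matrix.isUnit_iff_isUnit_det V).1 hV).ne_zero
      ((Matrix.isUnit_iff_isUnit_det U).1 hU).ne_zero
  have hdetB : B.det = C c * perPoly (Fin m) K := by
    have hVd : (V.map (C : K →+* MvPolynomial (Fin m × Fin m) K)).det = C V.det := by
      rw [← RingHom.mapMatrix_apply, ← RingHom.map_det]
    have hUd : (U.map (C : K →+* MvPolynomial (Fin m × Fin m) K)).det = C U.det := by
      rw [← RingHom.mapMatrix_apply, ← RingHom.map_det]
    rw [hB, Matrix.det_mul, Matrix.det_mul, hdet, hVd, hUd, hc, map_mul]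
    ring
  -- homogeneity of `perm_m` (degree `m ≥ 3`): its first and second partials have no constant term
  have hhom := perPoly_isHomogeneous (n := Fin m) (k := K)
  have hcc1 : ∀ a, constantCoeff (pderiv a (perPoly (Fin m) K)) = 0 := fun a =>
    constantCoeff_eq_zero_of_isHomogeneous hhom.pderiv (by rw [Fintype.card_fin]; omega)
  have hcc2 : ∀ a b, constantCoeff (pderiv b (pderiv a (perPoly (Fin m) K))) = 0 := fun a b =>
    constantCoeff_eq_zero_of_isHomogeneous hhom.pderiv.pderiv (by rw [Fintype.card_fin]; omega)
  -- (ABV) `Z₁₁ = 0`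
  have h00 : ∀ a, coeffMat B a i₀ i₀ = 0 := by
    intro a
    rw [← constantCoeff_pderiv_det hB1 hB0 a, hdetB, pderiv_C_mul, map_mul, constantCoeff_C,
      hcc1, mul_zero]
  -- (ABV) `Σ_j Z_{1j} Z_{j1} = 0`, polarised
  have hquad : ∀ a b, ∑ s, (coeffMat B a i₀ s * coeffMat B b s i₀ +
      coeffMat B b i₀ s * coeffMat B a s i₀) = 0 := by
    intro a b
    have h := constantCoeff_pderiv_pderiv_det hB1 hB0 h00 a b
    rw [hdetB, pderiv_C_mul, pderiv_C_mul, map_mul, constantCoeff_C, hcc2, mul_zero] at h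
    exact neg_eq_zero.1 h.symm
  -- ABV's linear map `G = (Z_{1j}, Z_{j1})_j` and `V(I) = ker G`
  let G : (Fin m × Fin m → K) →ₗ[K] (Fin n → K) × (Fin n → K) :=
    { toFun := fun x => (fun j => ∑ w, x w * coeffMat B w i₀ j, fun j => ∑ w, x w * coeffMat B w j i₀)
      map_add' := fun x y => by
        ext j <;> simp [add_mul, Finset.sum_add_distrib]
      map_smul' := fun r x => by
        ext j <;> simp [Finset.mul_sum, mul_assoc] }
  have hG1 : ∀ x j, (G x).1 j = ∑ w, x w * coeffMat B w i₀ j := fun _ _ => rfl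
  have hG2 : ∀ x j, (G x).2 j = ∑ w, x w * coeffMat B w j i₀ := fun _ _ => rfl
  have hN : ∀ (x : Fin m × Fin m → K) (i j : Fin n),
      (∑ w, x w • coeffMat B w) i j = ∑ w, x w * coeffMat B w i j := by
    intro x i j
    simp [Matrix.sum_apply]
  refine ⟨LinearMap.ker G, ?_, ?_⟩
  · -- `codim V(I) = dim im G ≤ n - 1`: `im G` is isotropic and lies in `w_{11} = 0`
    have hiso : ∀ z ∈ LinearMap.range G, ∀ z' ∈ LinearMap.range G,
        z.1 ⬝ᵥ z'.2 + z'.1 ⬝ᵥ z.2 = 0 := by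
      rintro _ ⟨x, rfl⟩ _ ⟨x', rfl⟩
      have e1 : ∑ j, (∑ w, x w * coeffMat B w i₀ j) * (∑ w', x' w' * coeffMat B w' j i₀) =
          ∑ w, ∑ w', x w * x' w' * ∑ j, coeffMat B w i₀ j * coeffMat B w' j i₀ := by
        calc ∑ j, (∑ w, x w * coeffMat B w i₀ j) * (∑ w', x' w' * coeffMat B w' j i₀)
            = ∑ j, ∑ w, ∑ w', (x w * coeffMat B w i₀ j) * (x' w' * coeffMat B w' j i₀) := by
              refine Finset.sum_congr rfl fun j _ => ?_
              rw [Finset.sum_mul_sum]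
          _ = ∑ w, ∑ w', ∑ j, (x w * coeffMat B w i₀ j) * (x' w' * coeffMat B w' j i₀) := by
              rw [Finset.sum_comm]
              refine Finset.sum_congr rfl fun w _ => ?_
              rw [Finset.sum_comm]
          _ = ∑ w, ∑ w', x w * x' w' * ∑ j, coeffMat B w i₀ j * coeffMat B w' j i₀ := by
              refine Finset.sum_congr rfl fun w _ => Finset.sum_congr rfl fun w' _ => ?_
              rw [Finset.mul_sum]
              refine Finset.sum_congr rfl fun j _ => ?_
              ring
      have e2 : ∑ j, (∑ w', x' w' * coeffMat B w' i₀ j) * (∑ w, x w * coeffMat B w j i₀) =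
          ∑ w, ∑ w', x w * x' w' * ∑ j, coeffMat B w' i₀ j * coeffMat B w j i₀ := by
        calc ∑ j, (∑ w', x' w' * coeffMat B w' i₀ j) * (∑ w, x w * coeffMat B w j i₀)
            = ∑ j, ∑ w', ∑ w, (x' w' * coeffMat B w' i₀ j) * (x w * coeffMat B w j i₀) := by
              refine Finset.sum_congr rfl fun j _ => ?_
              rw [Finset.sum_mul_sum]
          _ = ∑ w', ∑ w, ∑ j, (x' w' * coeffMat B w' i₀ j) * (x w * coeffMat B w j i₀) := by
              rw [Finset.sum_comm]
              refine Finset.sum_congr rfl fun w' _ => ?_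
              rw [Finset.sum_comm]
          _ = ∑ w, ∑ w', x w * x' w' * ∑ j, coeffMat B w' i₀ j * coeffMat B w j i₀ := by
              rw [Finset.sum_comm]
              refine Finset.sum_congr rfl fun w _ => Finset.sum_congr rfl fun w' _ => ?_
              rw [Finset.mul_sum]
              refine Finset.sum_congr rfl fun j _ => ?_
              ring
      show (∑ j, (∑ w, x w * coeffMat B w i₀ j) * (∑ w', x' w' * coeffMat B w' j i₀)) +
        ∑ j, (∑ w', x' w' * coeffMat B w' i₀ j) * (∑ w, x w * coeffMat B w j i₀) = 0
      rw [e1, e2, ← Finset.sum_add_distrib]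
      refine Finset.sum_eq_zero fun w _ => ?_
      rw [← Finset.sum_add_distrib]
      refine Finset.sum_eq_zero fun w' _ => ?_
      rw [← mul_add, ← Finset.sum_add_distrib, hquad w w', mul_zero]
    have h0' : ∀ z ∈ LinearMap.range G, z.1 i₀ = 0 ∧ z.2 i₀ = 0 := by
      rintro _ ⟨x, rfl⟩
      refine ⟨?_, ?_⟩
      · show ∑ w, x w * coeffMat B w i₀ i₀ = 0
        exact Finset.sum_eq_zero fun w _ => by rw [h00 w, mul_zero]
      · show ∑ w, x w * coeffMat B w i₀ i₀ = 0
        exact Finset.sum_eq_zero fun w _ => by rw [h00 w, mul_zero]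
    have hrange := finrank_add_one_le_card_of_isotropic (LinearMap.range G) i₀ hiso h0'
    have hrn := LinearMap.finrank_range_add_finrank_ker G
    rw [finrank_fintype_fun_eq_card, Fintype.card_prod, Fintype.card_fin] at hrn
    rw [Fintype.card_fin] at hrange
    generalize m * m = N at hrn ⊢
    omega
  · -- `V(I) ⊆ Sing(perm_m)`: all partials vanish on `ker G`
    intro x hx rc
    have hx' : G x = 0 := LinearMap.mem_ker.1 hx
    have hrow : ∀ j, (∑ w, x w • coeffMat B w) i₀ j = 0 := fun j => by
      rw [hN]
      exact congr_fun (congr_arg Prod.fst hx') j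
    have hcol : ∀ j, (∑ w, x w • coeffMat B w) j i₀ = 0 := fun j => by
      rw [hN]
      exact congr_fun (congr_arg Prod.snd hx') j
    have h := eval_pderiv_det_eq_zero hB1 hB0 rc (h00 rc) x hrow hcol
    rw [hdetB, pderiv_C_mul, map_mul, eval_C] at h
    exact (mul_eq_zero.1 h).resolve_left hc0

end AlperBogartVelasco

end Literature.Computability.AlgebraicComplexity
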